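import Summits.KontsevichZagierPeriods.Zeta5Search.Certificates.RayC1KernelClassCWR1A
import Summits.KontsevichZagierPeriods.Zeta5Search.Certificates.RayC1KernelClassCWR1B
import HarnessLib

/-!
# ζ(5) search — certificates: the CLASS-LAW WINDOW LIST of the ray RayC1, consumption round R1 (TYPER g17)

HONEST FRAMING: systematic search; no irrationality claim unless certified.  `p`-adic bookkeeping; nothing about `ζ(5)`.

OUR work (Summit side; typer seat, generation 17; generator `HOME/pub-zeta5-typer-g17/gen/gen_classround.py C1 … R1`).  The list
`c1CWR1` of the 31 PROVED class-law / atlas windows consumed in round R1 (parts `c1CWR1_i` with their adapters) and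
`c1CWR1_holds : ∀ c ∈ c1CWR1, c.Holds` — the hypothesis of `soundChecker_entryOK` for this round's table.
-/

noncomputable section

namespace Summit.KontsevichZagierPeriods.Zeta5Search.RayC1

open Summit.KontsevichZagierPeriods.Zeta5Search.RayKernel

/-- **The class-law window list of round R1.** -/
def c1CWR1 : List CWin := c1CWR1_0 ++ c1CWR1_1

/-- **Every window of round R1 holds** (the landed window theorems, by name). -/
theorem c1CWR1_holds : ∀ c ∈ c1CWR1, c.Holds := by
  intro c hc
  simp only [c1CWR1, List.mem_append] at hc
  rcases hc with h0 | h1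
  · exact c1CWR1_0_holds c h0
  · exact c1CWR1_1_holds c h1

end Summit.KontsevichZagierPeriods.Zeta5Search.RayC1
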